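import Mathlib
import HarnessLib
import Literature.Analysis.FluidPDE.TypeIAncientMild
import Literature.Analysis.FluidPDE.OseenSlice
import Literature.Analysis.FluidPDE.UlocKernelEstimates
import Literature.Analysis.FluidPDE.LerayVolterraComparison
import Literature.Analysis.FluidPDE.OseenDuhamelPairCalculus
import Summits.NavierStokesRegularity.NavierStokesRegularity.Theorems.QuarterLogPincerTruncationEdgeDefs
import Summits.NavierStokesRegularity.NavierStokesRegularity.Theorems.QuarterLogPincerTypeIQuantSubcubicExpFrameTools
import Summits.NavierStokesRegularity.NavierStokesRegularity.Theorems.QuarterLogPincerQuietCoreDefs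
import Summits.NavierStokesRegularity.NavierStokesRegularity.Theorems.QuarterLogPincerQuietCoreBudgetPassSlice
import Summits.NavierStokesRegularity.NavierStokesRegularity.Theorems.QuarterLogPincerQuietCoreBudgetPass
import Summits.NavierStokesRegularity.NavierStokesRegularity.Theorems.QuarterLogPincerQuietCoreRecedingTools
import Summits.NavierStokesRegularity.NavierStokesRegularity.Theorems.QuarterLogPincerQuietCoreRecessionLaw
import Summits.NavierStokesRegularity.NavierStokesRegularity.Theorems.QuarterLogPincerQuietCoreFarKick
import Summits.NavierStokesRegularity.NavierStokesRegularity.Theorems.QuarterLogPincerQuietCoreAssemblyTools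

/-!
# Route `QuarterLogPincer`, crux `TypeIQuantSubcubicExp` (stmt-NavierStokesRegularity-24077), line `quiet_core` —
# §1e part 1 (PROVED in-file v1.5; ported VERBATIM): `keyStep` — ONE bootstrap step of the receding-ball scheme

`keyStep`: Oseen representation from the quiet slice; heat part by T3, inside sources by the induction hypothesis + T2, Type-I far field
by T2 + T1, the un-hypothesised strip crudely (no time-continuity of `v` is used).
HONEST FRAME: estimates about HYPOTHETICAL Type-I ancient mild fields; nothing here bears on 24077, W7 or Navier–Stokes
regularity (OPEN).  Port by the pub-ns-dss typer (g36), DIRECTOR-NS KEY-NS #181/#182; bodies VERBATIM from tree `Lines/quiet_core.lean`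
v1.5 (sha12 d1a96bf31391, ns-idea-7 g10; critic of record idea-crit-4 g6); docstrings added where the line had none.
-/

noncomputable section

set_option linter.dupNamespace false

namespace Summit.NavierStokesRegularity.NavierStokesRegularity.Cruxes.TypeIQuantSubcubicExp.QuietCore

open MeasureTheory Set Function Metric Filter Topology
open scoped ENNReal NNReal
open Literature.Analysis Literature.Analysis.FluidPDE
open Summit.NavierStokesRegularity.NavierStokesRegularity.Cruxes.TypeIQuantSubcubicExp.TruncationEdge

section Assembly
open Real

set_option maxHeartbeats 4000000 in
/-- **T4 · KEY STEP of the receding-ball bootstrap.**  Fixed data: kernel constant `C`, a bound `I₁` for the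
kernel mass integral, constants `M ≤ M₁`, `c₀`, `κ`, `c₁` tied by `128 C I₁ c₀ ≤ 1`, `C M₁² (96π/κ) ≤ c₀/2`,
`c₁ ≥ 2 + 2|log κ| + |log(I₁²/(16π²))|`; a base time `s < 0` with `Φ(−s) ≤ 1/8` and `2^{3/2}·512·M₁·(−s) ≤ c₀`
(`Φ = recessPhi κ (−s) c₁`).  If `v` is Type-I ancient mild, `c₀/√(−s)`-quiet on `B(0,1)` at time `s`, and the
bound `‖v(t',y)‖ ≤ V(t') := 4c₀(−s)^{−3/8}(−t')^{−1/8}` holds on the receding balls `‖y‖ < 3/4 + Φ(−t')` for all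
`t' ∈ (s, t)`, then it holds at every `t'' ∈ [t, t + η) ∩ (s, 0)` for some `η > 0` (heat part by T3, inside
sources by the hypothesis, outside Type-I sources by T2 + T1, the un-hypothesised strip `[t, t'')` crudely). -/

theorem keyStep {C : ℝ} (hC : 0 < C)
    (hK : ∀ {τ : ℝ}, 0 < τ → ∀ z a b : EuclideanSpace ℝ (Fin 3),
      ‖oseenKernel τ z a b‖ ≤ C * (τ + ‖z‖ ^ 2) ^
        (-(((Module.finrank ℝ (EuclideanSpace ℝ (Fin 3)) : ℝ) + 1) / 2)) * ‖a‖ * ‖b‖)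
    {I₁ : ℝ} (hI₁ : (∫ w : EuclideanSpace ℝ (Fin 3), (1 + ‖w‖ ^ 2) ^
          (-(((Module.finrank ℝ (EuclideanSpace ℝ (Fin 3)) : ℝ) + 1) / 2))) ≤ I₁) (hI₁pos : 0 < I₁)
    {M M₁ c₀ κ c₁ : ℝ} (hM₁ : 0 < M₁) (hMM₁ : M ≤ M₁) (hc₀ : 0 < c₀) (hc₀I : 128 * C * I₁ * c₀ ≤ 1)
    (hκ : 0 < κ) (hκc : C * M₁ ^ 2 * (96 * π / κ) ≤ c₀ / 2)
    (hc₁ : 2 + 2 * |Real.log κ| + |Real.log (I₁ ^ 2 / (16 * π ^ 2))| ≤ c₁)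
    {s : ℝ} (hs : s < 0) (hΦb : recessPhi κ (-s) c₁ (-s) ≤ 1 / 8)
    (hheat : (2 : ℝ) ^ (3 / 2 : ℝ) * 512 * M₁ * (-s) ≤ c₀)
    {v : ℝ → EuclideanSpace ℝ (Fin 3) → EuclideanSpace ℝ (Fin 3)} (hv : IsTypeIAncientMild M v)
    (hq : ∀ y ∈ Metric.ball (0 : EuclideanSpace ℝ (Fin 3)) 1, ‖v s y‖ ≤ c₀ / Real.sqrt (-s))
    {t : ℝ} (hst : s ≤ t) (ht0 : t < 0)
    (hyp : ∀ t' ∈ Set.Ioo s t, ∀ y : EuclideanSpace ℝ (Fin 3), ‖y‖ < 3 / 4 + recessPhi κ (-s) c₁ (-t') →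
      ‖v t' y‖ ≤ 4 * c₀ * (-s) ^ (-(3 / 8 : ℝ)) * (-t') ^ (-(1 / 8 : ℝ))) :
    ∃ η : ℝ, 0 < η ∧ ∀ t'' : ℝ, s < t'' → t ≤ t'' → t'' < t + η → t'' < 0 →
      ∀ x : EuclideanSpace ℝ (Fin 3), ‖x‖ < 3 / 4 + recessPhi κ (-s) c₁ (-t'') →
        ‖v t'' x‖ ≤ 4 * c₀ * (-s) ^ (-(3 / 8 : ℝ)) * (-t'') ^ (-(1 / 8 : ℝ)) := by
  set I : ℝ := ∫ w : EuclideanSpace ℝ (Fin 3), (1 + ‖w‖ ^ 2) ^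
      (-(((Module.finrank ℝ (EuclideanSpace ℝ (Fin 3)) : ℝ) + 1) / 2)) with hI_def
  have hI0 : 0 ≤ I := integral_nonneg fun w => Real.rpow_nonneg (by positivity) _
  set b : ℝ := -s with hb_def
  have hb : 0 < b := by rw [hb_def]; linarith
  set Φ : ℝ → ℝ := recessPhi κ b c₁ with hΦ
  have hc₁2 : 2 ≤ c₁ := by
    have h1 := abs_nonneg (Real.log κ); have h2 := abs_nonneg (Real.log (I₁ ^ 2 / (16 * π ^ 2))); linarith
  have hc₁pos : 0 < c₁ := by linarith
  have hM0 : 0 ≤ M := hv.nonneg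
  set at_ : ℝ := -t with hat_def
  have hat : 0 < at_ := by rw [hat_def]; linarith
  -- the slack length
  set ρη : ℝ := c₀ * b ^ (-(3 / 8 : ℝ)) * at_ ^ (7 / 8 : ℝ) / (8 * C * M₁ ^ 2 * I₁) with hρη
  have hρη_pos : 0 < ρη := by rw [hρη]; positivity
  refine ⟨min (at_ / 2) (ρη ^ 2), lt_min (by linarith) (by positivity), ?_⟩
  intro t'' hst'' htt'' ht''η ht''0 x hx
  have hη1 : t'' < t + at_ / 2 := by linarith [min_le_left (at_ / 2) (ρη ^ 2)]
  have hη2 : t'' - t < ρη ^ 2 := by linarith [min_le_right (at_ / 2) (ρη ^ 2)]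
  set a'' : ℝ := -t'' with ha''_def
  have ha'' : 0 < a'' := by rw [ha''_def]; linarith
  have ha''b : a'' < b := by rw [ha''_def, hb_def]; linarith
  have ha''at : a'' ≤ at_ := by rw [ha''_def, hat_def]; linarith
  have ha''at2 : at_ / 2 < a'' := by rw [ha''_def]; linarith
  have hsqb : 0 < Real.sqrt b := Real.sqrt_pos.2 hb
  -- the basic rpow facts for the target
  have hb38 : 0 < b ^ (-(3 / 8 : ℝ)) := Real.rpow_pos_of_pos hb _
  have ha18 : 0 < a'' ^ (-(1 / 8 : ℝ)) := Real.rpow_pos_of_pos ha'' _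
  have hVpos : 0 < 4 * c₀ * b ^ (-(3 / 8 : ℝ)) * a'' ^ (-(1 / 8 : ℝ)) := by positivity
  have hbinv : 1 / Real.sqrt b ≤ b ^ (-(3 / 8 : ℝ)) * a'' ^ (-(1 / 8 : ℝ)) := by
    have h1 : 1 / Real.sqrt b = b ^ (-(3 / 8 : ℝ)) * b ^ (-(1 / 8 : ℝ)) := by
      rw [← Real.rpow_add hb, show (-(3 / 8 : ℝ)) + -(1 / 8 : ℝ) = -(1 / 2 : ℝ) by norm_num,
        Real.rpow_neg hb.le, Real.sqrt_eq_rpow, inv_eq_one_div]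
    rw [h1]
    exact mul_le_mul_of_nonneg_left (Real.rpow_le_rpow_of_nonpos ha'' ha''b.le (by norm_num)) hb38.le
  -- ### the representation from time `s`
  have hrep := hv.2.2.1 s t'' hst'' ht''0 x
  have hT0 : 0 < t'' - s := by linarith
  have hTb : t'' - s ≤ b := by rw [hb_def]; linarith
  -- ### HEAT PART (T3 with δ = 1/8)
  have hΦmono : Φ a'' ≤ Φ b := by rw [hΦ]; exact recessPhi_le hκ hb hc₁pos ha'' ha''b.le le_rfl
  have hΦb' : Φ b ≤ 1 / 8 := by rw [hΦ, hb_def]; exact hΦb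
  have hxn : ‖x‖ < 3 / 4 + Φ a'' := by rw [hΦ, ha''_def, hb_def]; exact hx
  have hheat_le : ‖heatFlow (v s) (t'' - s) x‖ ≤ 2 * c₀ / Real.sqrt b := by
    rw [heatFlow_of_pos _ hT0]
    have hin : ∀ z : EuclideanSpace ℝ (Fin 3), ‖z - x‖ < 1 / 8 → ‖v s z‖ ≤ c₀ / Real.sqrt b := by
      intro z hz
      have hz1 : ‖z‖ < 1 := by
        have := norm_le_norm_add_norm_sub' z x
        have h2 : ‖z‖ ≤ ‖x‖ + ‖z - x‖ := by
          calc ‖z‖ = ‖x + (z - x)‖ := by rw [add_sub_cancel]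
            _ ≤ ‖x‖ + ‖z - x‖ := norm_add_le _ _
        linarith
      have := hq z (mem_ball_zero_iff.2 hz1)
      rwa [hb_def]
    have hout : ∀ z : EuclideanSpace ℝ (Fin 3), ‖v s z‖ ≤ M₁ / Real.sqrt b := by
      intro z
      refine (hv.norm_le hs z).trans ?_
      rw [← hb_def]
      exact div_le_div_of_nonneg_right hMM₁ hsqb.le
    have hT3 := norm_heatExtension_two_region (f := v s) (by positivity) (by positivity)
      (by norm_num : (0 : ℝ) ≤ 1 / 8) hT0 hin hout
    refine hT3.trans ?_
    -- the Gaussian tail: `exp(−(1/8)²/(8σ)) ≤ 512 σ ≤ 512 b`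
    have hexp : Real.exp (-((1 / 8 : ℝ) ^ 2 / (8 * (t'' - s)))) ≤ 512 * b := by
      have hX : 0 < (1 / 8 : ℝ) ^ 2 / (8 * (t'' - s)) := by positivity
      -- (the line's `exp_neg_le_one_div` ≡ tree `Literature…Tao2016.exp_neg_le_inv` (dedup); inlined)
      have hexp1 : Real.exp (-((1 / 8 : ℝ) ^ 2 / (8 * (t'' - s)))) ≤ 1 / ((1 / 8 : ℝ) ^ 2 / (8 * (t'' - s))) := by
        rw [Real.exp_neg, inv_eq_one_div]
        exact one_div_le_one_div_of_le hX (by linarith [Real.add_one_le_exp ((1 / 8 : ℝ) ^ 2 / (8 * (t'' - s)))])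
      refine hexp1.trans ?_
      rw [one_div_div]
      have : 8 * (t'' - s) / (1 / 8 : ℝ) ^ 2 = 512 * (t'' - s) := by norm_num; ring
      rw [this]; linarith
    have htail : (2 : ℝ) ^ (3 / 2 : ℝ) * (M₁ / Real.sqrt b) * Real.exp (-((1 / 8 : ℝ) ^ 2 / (8 * (t'' - s)))) ≤
        c₀ / Real.sqrt b := by
      have h1 : (2 : ℝ) ^ (3 / 2 : ℝ) * (M₁ / Real.sqrt b) * Real.exp (-((1 / 8 : ℝ) ^ 2 / (8 * (t'' - s)))) ≤
          (2 : ℝ) ^ (3 / 2 : ℝ) * (M₁ / Real.sqrt b) * (512 * b) :=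
        mul_le_mul_of_nonneg_left hexp (by positivity)
      refine h1.trans ?_
      rw [show (2 : ℝ) ^ (3 / 2 : ℝ) * (M₁ / Real.sqrt b) * (512 * b) =
        ((2 : ℝ) ^ (3 / 2 : ℝ) * 512 * M₁ * b) / Real.sqrt b by ring]
      exact div_le_div_of_nonneg_right (by rw [hb_def]; exact hheat) hsqb.le
    calc c₀ / Real.sqrt b + (2 : ℝ) ^ (3 / 2 : ℝ) * (M₁ / Real.sqrt b) *
          Real.exp (-((1 / 8 : ℝ) ^ 2 / (8 * (t'' - s))))
        ≤ c₀ / Real.sqrt b + c₀ / Real.sqrt b := by linarith [htail]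
      _ = 2 * c₀ / Real.sqrt b := by ring
  -- ### DUHAMEL PART: the majorant
  set K₁ : ℝ := 16 * C * I₁ * c₀ ^ 2 * b ^ (-(3 / 4 : ℝ)) with hK₁
  set g : ℝ → ℝ := fun u => u⁻¹ * min (I₁ * (u - a'') ^ (-(1 / 2 : ℝ))) (4 * π / (Φ u - Φ a'')) with hg
  set K₃ : ℝ := 4 * C * M₁ ^ 2 * I₁ / at_ with hK₃
  have hK₁0 : 0 ≤ K₁ := by rw [hK₁]; positivity
  have hK₃0 : 0 ≤ K₃ := by rw [hK₃]; positivity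
  set m : ℝ → ℝ := fun τ => K₁ * (t'' - τ) ^ (-(3 / 4 : ℝ)) + C * M₁ ^ 2 * g (-τ) +
    (Ioi t).indicator (fun τ => K₃ * (t'' - τ) ^ (-(1 / 2 : ℝ))) τ with hm
  -- integrability of the three pieces on `Ioo s t''`
  have hk34 : IntegrableOn (fun τ : ℝ => (t'' - τ) ^ (-(3 / 4 : ℝ))) (Ioo s t'') :=
    integrableOn_sub_rpow_Ioo (by norm_num)
  have hk12 : IntegrableOn (fun τ : ℝ => (t'' - τ) ^ (-(1 / 2 : ℝ))) (Ioo s t'') :=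
    integrableOn_sub_rpow_Ioo (by norm_num)
  have hgII : IntervalIntegrable g volume a'' b := by
    rw [hg]; exact intervalIntegrable_farKick hκ hI₁pos ha'' ha''b hc₁2
  have hg_neg : IntegrableOn (fun τ : ℝ => g (-τ)) (Ioo s t'') := by
    have h1 := hgII.comp_sub_left 0
    simp only [zero_sub] at h1
    -- `h1 : IntervalIntegrable (fun x => g (-x)) volume (-a'') (-b)`
    have h2 := h1.symm
    rw [show -b = s by rw [hb_def, neg_neg], show -a'' = t'' by rw [ha''_def, neg_neg],
      intervalIntegrable_iff_integrableOn_Ioc_of_le hst''.le] at h2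
    exact h2.mono_set Ioo_subset_Ioc_self
  have hm3 : IntegrableOn (fun τ : ℝ => (Ioi t).indicator (fun τ => K₃ * (t'' - τ) ^ (-(1 / 2 : ℝ))) τ)
      (Ioo s t'') := (hk12.const_mul K₃).indicator measurableSet_Ioi
  have hmi : IntegrableOn m (Ioo s t'') := by
    rw [hm]; exact ((hk34.const_mul K₁).add (hg_neg.const_mul _)).add hm3
  -- ### the pointwise slice bound, a.e. on `Ioo s t''` (off `τ = t`)
  have hne_t : ∀ᵐ τ : ℝ ∂(volume.restrict (Ioo s t'')), τ ≠ t := by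
    have h : ∀ᵐ τ : ℝ ∂volume, τ ≠ t := by
      have : ({t}ᶜ : Set ℝ) ∈ ae (volume : Measure ℝ) := compl_mem_ae_iff.2 (measure_singleton t)
      filter_upwards [this] with τ hτ
      simpa using hτ
    exact ae_restrict_of_ae h
  have hptw : ∀ᵐ τ : ℝ ∂(volume.restrict (Ioo s t'')), ‖oseenSlice (t'' - τ) (v τ) (v τ) x‖ ≤ m τ := by
    filter_upwards [ae_restrict_mem measurableSet_Ioo, hne_t] with τ hτ hτne
    have hτ0 : τ < 0 := hτ.2.trans ht''0
    have hu : 0 < -τ := by linarith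
    have hσ : 0 < t'' - τ := by linarith [hτ.2]
    have hσu : t'' - τ ≤ -τ := by linarith
    -- Type-I everywhere at time `τ`
    set Mf : ℝ := M₁ / Real.sqrt (-τ) with hMf
    have hsqτ : 0 < Real.sqrt (-τ) := Real.sqrt_pos.2 hu
    have hfar : ∀ y : EuclideanSpace ℝ (Fin 3), ‖v τ y‖ ≤ Mf := fun y =>
      (hv.norm_le hτ0 y).trans (div_le_div_of_nonneg_right hMM₁ hsqτ.le)
    have hMf0 : 0 ≤ Mf := by rw [hMf]; positivity
    have hMf2 : Mf ^ 2 = M₁ ^ 2 / (-τ) := by rw [hMf, div_pow, Real.sq_sqrt hu.le]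
    -- the three majorant pieces are nonnegative
    have hm1nn : 0 ≤ K₁ * (t'' - τ) ^ (-(3 / 4 : ℝ)) := mul_nonneg hK₁0 (Real.rpow_nonneg hσ.le _)
    have hgnn : 0 ≤ g (-τ) := by
      rw [hg]
      have := farKick_nonneg (I := I₁) (u := -τ) hκ hb hc₁pos hI₁pos.le ha''
        (by rw [ha''_def]; linarith [hτ.2]) (by rw [hb_def]; linarith [hτ.1])
      simpa only [sub_neg_eq_add] using this
    have hm2nn : 0 ≤ C * M₁ ^ 2 * g (-τ) := mul_nonneg (by positivity) hgnn
    have hm3nn : 0 ≤ (Ioi t).indicator (fun τ => K₃ * (t'' - τ) ^ (-(1 / 2 : ℝ))) τ := by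
      by_cases h : τ ∈ Ioi t
      · rw [indicator_of_mem h]; exact mul_nonneg hK₃0 (Real.rpow_nonneg hσ.le _)
      · rw [indicator_of_notMem h]
    -- monotonicity in the kernel-mass constant
    have hIσ : I * (t'' - τ) ^ (-(1 / 2 : ℝ)) ≤ I₁ * (t'' - τ) ^ (-(1 / 2 : ℝ)) :=
      mul_le_mul_of_nonneg_right hI₁ (Real.rpow_nonneg hσ.le _)
    rcases lt_or_gt_of_ne hτne with hτt | hτt
    · -- CASE τ < t: inside by the hypothesis, outside by Type-I (T2), then T1's integrand
      set ρ : ℝ := 3 / 4 + Φ (-τ) with hρ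
      set d : ℝ := Φ (-τ) - Φ a'' with hd
      have hdpos : 0 < d := by
        rw [hd, hΦ]; exact sub_pos.2 (recessPhi_lt hκ hb hc₁pos ha'' (by rw [ha''_def]; linarith [hτ.2])
          (by rw [hb_def]; linarith [hτ.1]))
      set P : ℝ := (4 * c₀ * b ^ (-(3 / 8 : ℝ)) * (-τ) ^ (-(1 / 8 : ℝ))) ^ 2 with hP
      have hP0 : 0 ≤ P := by rw [hP]; positivity
      have hin : ∀ y : EuclideanSpace ℝ (Fin 3), ‖y‖ < ρ → ‖v τ y‖ ^ 2 ≤ P := by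
        intro y hy
        have h := hyp τ ⟨hτ.1, hτt⟩ y (by rw [hρ] at hy; exact hy)
        rw [hP]
        exact pow_le_pow_left₀ (norm_nonneg _) h 2
      have hxρ : ‖x‖ ≤ ρ - d := by rw [hρ, hd]; linarith
      have hT2 := norm_oseenSlice_receding hC hK hσ hP0 hdpos (ρ := ρ) (Mf := Mf) hin
        (fun y _ => hfar y) hxρ
      -- term 1: `C P I σ^{-1/2} ≤ K₁ σ^{-3/4}`
      have hP_eq : P = 16 * c₀ ^ 2 * b ^ (-(3 / 4 : ℝ)) * (-τ) ^ (-(1 / 4 : ℝ)) := by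
        rw [hP, mul_pow, mul_pow, mul_pow, ← Real.rpow_mul_natCast hb.le, ← Real.rpow_mul_natCast hu.le]
        norm_num
      have h1 : C * P * I * (t'' - τ) ^ (-(1 / 2 : ℝ)) ≤ K₁ * (t'' - τ) ^ (-(3 / 4 : ℝ)) := by
        have hq14 : (-τ) ^ (-(1 / 4 : ℝ)) ≤ (t'' - τ) ^ (-(1 / 4 : ℝ)) :=
          Real.rpow_le_rpow_of_nonpos hσ hσu (by norm_num)
        have hσ34 : (t'' - τ) ^ (-(1 / 4 : ℝ)) * (t'' - τ) ^ (-(1 / 2 : ℝ)) = (t'' - τ) ^ (-(3 / 4 : ℝ)) := by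
          rw [← Real.rpow_add hσ]; norm_num
        have hCPI : C * P * I * (t'' - τ) ^ (-(1 / 2 : ℝ)) ≤ C * P * (I₁ * (t'' - τ) ^ (-(1 / 2 : ℝ))) := by
          rw [mul_assoc (C * P)]; exact mul_le_mul_of_nonneg_left hIσ (by positivity)
        refine hCPI.trans ?_
        rw [hP_eq, hK₁]
        have hrest : 0 ≤ C * (16 * c₀ ^ 2 * b ^ (-(3 / 4 : ℝ))) * I₁ * (t'' - τ) ^ (-(1 / 2 : ℝ)) := by positivity
        calc C * (16 * c₀ ^ 2 * b ^ (-(3 / 4 : ℝ)) * (-τ) ^ (-(1 / 4 : ℝ))) * (I₁ * (t'' - τ) ^ (-(1 / 2 : ℝ)))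
            = (C * (16 * c₀ ^ 2 * b ^ (-(3 / 4 : ℝ))) * I₁ * (t'' - τ) ^ (-(1 / 2 : ℝ))) * (-τ) ^ (-(1 / 4 : ℝ)) := by
              ring
          _ ≤ (C * (16 * c₀ ^ 2 * b ^ (-(3 / 4 : ℝ))) * I₁ * (t'' - τ) ^ (-(1 / 2 : ℝ))) * (t'' - τ) ^ (-(1 / 4 : ℝ)) :=
              mul_le_mul_of_nonneg_left hq14 hrest
          _ = 16 * C * I₁ * c₀ ^ 2 * b ^ (-(3 / 4 : ℝ)) * ((t'' - τ) ^ (-(1 / 4 : ℝ)) * (t'' - τ) ^ (-(1 / 2 : ℝ))) := by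
              ring
          _ = 16 * C * I₁ * c₀ ^ 2 * b ^ (-(3 / 4 : ℝ)) * (t'' - τ) ^ (-(3 / 4 : ℝ)) := by rw [hσ34]
      -- term 2: `C Mf² min(I σ^{-1/2}, 4π/d) ≤ C M₁² g(−τ)`
      have h2 : C * Mf ^ 2 * min (I * (t'' - τ) ^ (-(1 / 2 : ℝ))) (4 * π / d) ≤ C * M₁ ^ 2 * g (-τ) := by
        have hmin : min (I * (t'' - τ) ^ (-(1 / 2 : ℝ))) (4 * π / d) ≤
            min (I₁ * (-τ - a'') ^ (-(1 / 2 : ℝ))) (4 * π / (Φ (-τ) - Φ a'')) := by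
          have hσeq : -τ - a'' = t'' - τ := by rw [ha''_def]; ring
          rw [hσeq, ← hd]
          exact min_le_min_right _ hIσ
        have hmin0 : 0 ≤ min (I * (t'' - τ) ^ (-(1 / 2 : ℝ))) (4 * π / d) :=
          le_min (mul_nonneg hI0 (Real.rpow_nonneg hσ.le _)) (div_nonneg (by positivity) hdpos.le)
        rw [hg, hMf2]
        calc C * (M₁ ^ 2 / -τ) * min (I * (t'' - τ) ^ (-(1 / 2 : ℝ))) (4 * π / d)
            = C * M₁ ^ 2 * ((-τ)⁻¹ * min (I * (t'' - τ) ^ (-(1 / 2 : ℝ))) (4 * π / d)) := by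
              rw [div_eq_mul_inv]; ring
          _ ≤ C * M₁ ^ 2 * ((-τ)⁻¹ * min (I₁ * (-τ - a'') ^ (-(1 / 2 : ℝ))) (4 * π / (Φ (-τ) - Φ a''))) :=
              mul_le_mul_of_nonneg_left (mul_le_mul_of_nonneg_left hmin (inv_nonneg.2 hu.le)) (by positivity)
      rw [hm]
      show ‖oseenSlice (t'' - τ) (v τ) (v τ) x‖ ≤ K₁ * (t'' - τ) ^ (-(3 / 4 : ℝ)) + C * M₁ ^ 2 * g (-τ) +
        (Ioi t).indicator (fun τ => K₃ * (t'' - τ) ^ (-(1 / 2 : ℝ))) τ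
      linarith [hT2, h1, h2, hm3nn]
    · -- CASE t < τ: the crude whole-space bound `2 C Mf² I₁ σ^{-1/2} ≤ K₃ σ^{-1/2}`
      have hin : ∀ y : EuclideanSpace ℝ (Fin 3), ‖y‖ < ‖x‖ + 1 → ‖v τ y‖ ^ 2 ≤ Mf ^ 2 := fun y _ =>
        pow_le_pow_left₀ (norm_nonneg _) (hfar y) 2
      have hT2 := norm_oseenSlice_receding hC hK hσ (sq_nonneg Mf) one_pos (ρ := ‖x‖ + 1) (Mf := Mf) hin
        (fun y _ => hfar y) (by linarith : ‖x‖ ≤ ‖x‖ + 1 - 1)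
      have hmin : min (I * (t'' - τ) ^ (-(1 / 2 : ℝ))) (4 * π / 1) ≤ I₁ * (t'' - τ) ^ (-(1 / 2 : ℝ)) :=
        (min_le_left _ _).trans hIσ
      have hCMI : C * Mf ^ 2 * I * (t'' - τ) ^ (-(1 / 2 : ℝ)) ≤ C * Mf ^ 2 * (I₁ * (t'' - τ) ^ (-(1 / 2 : ℝ))) := by
        rw [mul_assoc (C * Mf ^ 2)]; exact mul_le_mul_of_nonneg_left hIσ (by positivity)
      have hslice : ‖oseenSlice (t'' - τ) (v τ) (v τ) x‖ ≤ 2 * C * Mf ^ 2 * (I₁ * (t'' - τ) ^ (-(1 / 2 : ℝ))) := by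
        have h2 : C * Mf ^ 2 * min (I * (t'' - τ) ^ (-(1 / 2 : ℝ))) (4 * π / 1) ≤
            C * Mf ^ 2 * (I₁ * (t'' - τ) ^ (-(1 / 2 : ℝ))) := mul_le_mul_of_nonneg_left hmin (by positivity)
        linarith [hT2, hCMI, h2]
      -- `Mf² = M₁²/(−τ) ≤ 2 M₁²/a_t`
      have hMf_le : Mf ^ 2 ≤ M₁ ^ 2 * (2 / at_) := by
        rw [hMf2, div_eq_mul_inv]
        refine mul_le_mul_of_nonneg_left ?_ (sq_nonneg _)
        rw [inv_eq_one_div, div_le_div_iff₀ hu hat]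
        have : at_ / 2 < -τ := by linarith [hτ.2]
        linarith
      have hind : (Ioi t).indicator (fun τ => K₃ * (t'' - τ) ^ (-(1 / 2 : ℝ))) τ = K₃ * (t'' - τ) ^ (-(1 / 2 : ℝ)) :=
        indicator_of_mem (mem_Ioi.2 hτt) _
      rw [hm]
      show ‖oseenSlice (t'' - τ) (v τ) (v τ) x‖ ≤ K₁ * (t'' - τ) ^ (-(3 / 4 : ℝ)) + C * M₁ ^ 2 * g (-τ) +
        (Ioi t).indicator (fun τ => K₃ * (t'' - τ) ^ (-(1 / 2 : ℝ))) τ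
      rw [hind]
      have h3 : 2 * C * Mf ^ 2 * (I₁ * (t'' - τ) ^ (-(1 / 2 : ℝ))) ≤ K₃ * (t'' - τ) ^ (-(1 / 2 : ℝ)) := by
        have hA : 0 ≤ 2 * C * (I₁ * (t'' - τ) ^ (-(1 / 2 : ℝ))) := by positivity
        calc 2 * C * Mf ^ 2 * (I₁ * (t'' - τ) ^ (-(1 / 2 : ℝ)))
            = (2 * C * (I₁ * (t'' - τ) ^ (-(1 / 2 : ℝ)))) * Mf ^ 2 := by ring
          _ ≤ (2 * C * (I₁ * (t'' - τ) ^ (-(1 / 2 : ℝ)))) * (M₁ ^ 2 * (2 / at_)) :=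
              mul_le_mul_of_nonneg_left hMf_le hA
          _ = K₃ * (t'' - τ) ^ (-(1 / 2 : ℝ)) := by rw [hK₃]; field_simp; ring
      linarith [hslice, h3, hm1nn, hm2nn]
  -- ### the three integrals
  have hInt1 : ∫ τ in Ioo s t'', K₁ * (t'' - τ) ^ (-(3 / 4 : ℝ)) ≤ c₀ / 2 * (1 / Real.sqrt b) := by
    rw [integral_const_mul, setIntegral_Ioo_sub_rpow_neg_three_quarters hst''.le]
    have hq14 : (t'' - s) ^ (1 / 4 : ℝ) ≤ b ^ (1 / 4 : ℝ) := Real.rpow_le_rpow hT0.le hTb (by norm_num)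
    have hbb : b ^ (-(3 / 4 : ℝ)) * b ^ (1 / 4 : ℝ) = 1 / Real.sqrt b := by
      rw [← Real.rpow_add hb, show (-(3 / 4 : ℝ)) + 1 / 4 = -(1 / 2 : ℝ) by norm_num, Real.rpow_neg hb.le,
        Real.sqrt_eq_rpow, inv_eq_one_div]
    have hb34 : 0 ≤ b ^ (-(3 / 4 : ℝ)) := Real.rpow_nonneg hb.le _
    calc K₁ * (4 * (t'' - s) ^ (1 / 4 : ℝ)) = 64 * C * I₁ * c₀ ^ 2 * (b ^ (-(3 / 4 : ℝ)) * (t'' - s) ^ (1 / 4 : ℝ)) := by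
          rw [hK₁]; ring
      _ ≤ 64 * C * I₁ * c₀ ^ 2 * (b ^ (-(3 / 4 : ℝ)) * b ^ (1 / 4 : ℝ)) := by gcongr
      _ = (128 * C * I₁ * c₀) * (c₀ / 2) * (1 / Real.sqrt b) := by rw [hbb]; ring
      _ ≤ 1 * (c₀ / 2) * (1 / Real.sqrt b) := by gcongr
      _ = c₀ / 2 * (1 / Real.sqrt b) := by ring
  have hInt2 : ∫ τ in Ioo s t'', C * M₁ ^ 2 * g (-τ) ≤ c₀ / 2 * (b ^ (-(3 / 8 : ℝ)) * a'' ^ (-(1 / 8 : ℝ))) := by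
    rw [integral_const_mul]
    have hsub : ∫ τ in Ioo s t'', g (-τ) = ∫ u in a''..b, g u := by
      rw [← integral_Ioc_eq_integral_Ioo, ← intervalIntegral.integral_of_le hst''.le,
        intervalIntegral.integral_comp_neg, show -t'' = a'' by rw [ha''_def], show -s = b by rw [hb_def]]
    rw [hsub]
    have hT1 : ∫ u in a''..b, g u ≤ 96 * π / κ * b ^ (-(3 / 8 : ℝ)) * a'' ^ (-(1 / 8 : ℝ)) := by
      rw [hg, hΦ]; exact farKick_integral_le hκ hI₁pos ha'' ha''b hc₁
    calc C * M₁ ^ 2 * ∫ u in a''..b, g u ≤ C * M₁ ^ 2 * (96 * π / κ * b ^ (-(3 / 8 : ℝ)) * a'' ^ (-(1 / 8 : ℝ))) :=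
          mul_le_mul_of_nonneg_left hT1 (by positivity)
      _ = (C * M₁ ^ 2 * (96 * π / κ)) * (b ^ (-(3 / 8 : ℝ)) * a'' ^ (-(1 / 8 : ℝ))) := by ring
      _ ≤ c₀ / 2 * (b ^ (-(3 / 8 : ℝ)) * a'' ^ (-(1 / 8 : ℝ))) :=
          mul_le_mul_of_nonneg_right hκc (by positivity)
  have hInt3 : ∫ τ in Ioo s t'', (Ioi t).indicator (fun τ => K₃ * (t'' - τ) ^ (-(1 / 2 : ℝ))) τ ≤
      c₀ * (b ^ (-(3 / 8 : ℝ)) * a'' ^ (-(1 / 8 : ℝ))) := by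
    rw [integral_indicator measurableSet_Ioi, Measure.restrict_restrict measurableSet_Ioi,
      show Ioi t ∩ Ioo s t'' = Ioo t t'' from Set.ext fun τ =>
        ⟨fun h => ⟨h.1, h.2.2⟩, fun h => ⟨h.1, lt_of_le_of_lt hst h.1, h.2⟩⟩,
      integral_const_mul, setIntegral_Ioo_sub_rpow_neg_half htt'']
    -- `K₃ · 2 (t''−t)^{1/2} ≤ K₃ · 2 ρη = c₀ b^{-3/8} a_t^{-1/8} ≤ c₀ b^{-3/8} a''^{-1/8}`
    have hroot : (t'' - t) ^ (1 / 2 : ℝ) ≤ ρη := by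
      have h1 : (t'' - t) ^ (1 / 2 : ℝ) ≤ (ρη ^ 2) ^ (1 / 2 : ℝ) :=
        Real.rpow_le_rpow (by linarith) hη2.le (by norm_num)
      have h2 : (ρη ^ 2) ^ (1 / 2 : ℝ) = ρη := by rw [← Real.sqrt_eq_rpow, Real.sqrt_sq hρη_pos.le]
      rw [h2] at h1
      exact h1
    have hat18 : at_ ^ (-(1 / 8 : ℝ)) ≤ a'' ^ (-(1 / 8 : ℝ)) :=
      Real.rpow_le_rpow_of_nonpos ha'' ha''at (by norm_num)
    have hat_split : at_ ^ (7 / 8 : ℝ) / at_ = at_ ^ (-(1 / 8 : ℝ)) := by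
      rw [div_eq_mul_inv, ← Real.rpow_neg_one, ← Real.rpow_add hat]; norm_num
    calc K₃ * (2 * (t'' - t) ^ (1 / 2 : ℝ)) ≤ K₃ * (2 * ρη) := by gcongr
      _ = c₀ * b ^ (-(3 / 8 : ℝ)) * (at_ ^ (7 / 8 : ℝ) / at_) := by
          rw [hK₃, hρη]; field_simp; ring
      _ = c₀ * (b ^ (-(3 / 8 : ℝ)) * at_ ^ (-(1 / 8 : ℝ))) := by rw [hat_split]; ring
      _ ≤ c₀ * (b ^ (-(3 / 8 : ℝ)) * a'' ^ (-(1 / 8 : ℝ))) := by gcongr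
  have hDuh : ‖oseenDuhamel 1 s v v t'' x‖ ≤ c₀ / 2 * (1 / Real.sqrt b) +
      c₀ / 2 * (b ^ (-(3 / 8 : ℝ)) * a'' ^ (-(1 / 8 : ℝ))) + c₀ * (b ^ (-(3 / 8 : ℝ)) * a'' ^ (-(1 / 8 : ℝ))) := by
    rw [oseenDuhamel_one_eq_setIntegral_oseenSlice]
    refine (norm_integral_le_of_norm_le hmi hptw).trans ?_
    have e1 : ∫ τ in Ioo s t'', m τ = (∫ τ in Ioo s t'', (K₁ * (t'' - τ) ^ (-(3 / 4 : ℝ)) + C * M₁ ^ 2 * g (-τ))) +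
        ∫ τ in Ioo s t'', (Ioi t).indicator (fun τ => K₃ * (t'' - τ) ^ (-(1 / 2 : ℝ))) τ := by
      rw [hm]; exact integral_add ((hk34.const_mul K₁).add (hg_neg.const_mul _)) hm3
    have e2 : ∫ τ in Ioo s t'', (K₁ * (t'' - τ) ^ (-(3 / 4 : ℝ)) + C * M₁ ^ 2 * g (-τ)) =
        (∫ τ in Ioo s t'', K₁ * (t'' - τ) ^ (-(3 / 4 : ℝ))) + ∫ τ in Ioo s t'', C * M₁ ^ 2 * g (-τ) :=
      integral_add (hk34.const_mul K₁) (hg_neg.const_mul _)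
    rw [e1, e2]
    linarith [hInt1, hInt2, hInt3]
  -- ### total
  rw [hrep]
  have hgoal : 4 * c₀ * (-s) ^ (-(3 / 8 : ℝ)) * (-t'') ^ (-(1 / 8 : ℝ)) =
      4 * c₀ * (b ^ (-(3 / 8 : ℝ)) * a'' ^ (-(1 / 8 : ℝ))) := by rw [hb_def, ha''_def]; ring
  rw [hgoal]
  have hW : 0 ≤ b ^ (-(3 / 8 : ℝ)) * a'' ^ (-(1 / 8 : ℝ)) := by positivity
  calc ‖heatFlow (v s) (t'' - s) x - oseenDuhamel 1 s v v t'' x‖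
      ≤ ‖heatFlow (v s) (t'' - s) x‖ + ‖oseenDuhamel 1 s v v t'' x‖ := norm_sub_le _ _
    _ ≤ 2 * c₀ / Real.sqrt b + (c₀ / 2 * (1 / Real.sqrt b) +
          c₀ / 2 * (b ^ (-(3 / 8 : ℝ)) * a'' ^ (-(1 / 8 : ℝ))) + c₀ * (b ^ (-(3 / 8 : ℝ)) * a'' ^ (-(1 / 8 : ℝ)))) :=
        add_le_add hheat_le hDuh
    _ = (5 / 2 * c₀) * (1 / Real.sqrt b) + (3 / 2 * c₀) * (b ^ (-(3 / 8 : ℝ)) * a'' ^ (-(1 / 8 : ℝ))) := by ring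
    _ ≤ (5 / 2 * c₀) * (b ^ (-(3 / 8 : ℝ)) * a'' ^ (-(1 / 8 : ℝ))) +
          (3 / 2 * c₀) * (b ^ (-(3 / 8 : ℝ)) * a'' ^ (-(1 / 8 : ℝ))) := by
        gcongr
    _ = 4 * c₀ * (b ^ (-(3 / 8 : ℝ)) * a'' ^ (-(1 / 8 : ℝ))) := by ring

end Assembly

end Summit.NavierStokesRegularity.NavierStokesRegularity.Cruxes.TypeIQuantSubcubicExp.QuietCore

end
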